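import Literature.MathematicalPhysics.QuantumFieldTheory.Balaban1983to89.B3Op116HolderKernelRegularTorus

/-!
# Bałaban, *(Higgs)₂,₃ quantum fields in a finite volume III. Renormalization* [B3] — THE HÖLDER QUOTIENT OF THE ROW DERIVATIVE OF
THE KERNEL OF (1.16) p. 414 ON THE TORUS WHEN THE OUTER FACTOR IS `G_k(T,Ã+B̃)` (`n = 0`), for all `n′ ≥ 1` with `n′ + 1 − α > d` — the
one-sided corner of FILE 4γ of the cell's programme for the analytic half of (1.16)

statement-level skeleton of published theorems with citation tags; proofs where landed; nothing here is a claim about the Yang–Mills mass gap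

T. Bałaban, Commun. Math. Phys. **88** (1983) 411–445 [cite: Balaban1983Higgs3]; part I, Commun. Math. Phys. **85** (1982) 603–636
[cite: Balaban1982Higgs1].  PDFs held: `paper:balaban1983-higgs-2-3-quantum-fields-finite-volume` (journal page = PDF page + 410;
p. 414 = `p0004.txt`, p. 426 = `p0016.txt`), `paper:balaban1982-cmp85-higgs23-i` (p. 610 = `p0008.txt`, p. 619 = `p0017.txt`).

CITATION HEADER (lean-in-tree rule).  Cell `lit-balaban` (HOME `run/shared/lean/pub/lit-balaban/`), proof seat **p35** gen 23
(unit `lit-balaban-p35`); TAKING line HOME/STATUS 2026-08-23T08:18:13Z (free-target protocol G.5-34(d); the row owner r15's word to p40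
2026-08-23T07:25:03Z *«the n′ = 0 / n = 0 corner can ride a v1.1»*); design `lit-balaban-p35/DESIGN-FILE4.md` §11 (the open item of gen 22).
SKELETON rows **B3.Eq1.16 (analytic half)** / **B3.Eq2.5** (fold owner r15) — LOCATED MEMBER, no head claim; decl of record
`B3Sect2StatementsPart2.ScaledKernels.Ineq25At` (r15), binder `hH` of p40's `B3Ineq25Op116Smooth.ineq25At_op116_smooth_torus_of_bounds`
at `(n, n′) = (0, n′+1)` (the binder `hH′` at `(n′+1, 0)` is FILE 4γ's `kernel116_holder_le n′ 0`).  Programme files: FILE 4α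
`B3Op116LeibnizRows` (p35), FILE 4β₁ `B3Op116MajorantStep` (p35), FILE 4β₂ `B3Op116DKernelRegularTorus` (p35: `step_state`, `base_state`),
FILE 4γ `B3Op116HolderKernelRegularTorus` (p35: `holT`, `hcol`, `holC`, `norm_holT_G_srcV_le`, `row_le_of_kernel_le_add`,
`kernel116_holder_le`), the (2.5) assembly `B3Ineq25Op116RegularTorus` (p40, `n, n′ ≥ 1`).
USED BY NAME, never restated: the above and r14's `B3Op116SourceForm.{srcV, op116_zero_zero_apply, op116_succ_left_apply,
op116_succ_right_apply}`, `B3Op116KernelRegularTorus.norm_mapE_avgSrc_le_block`, p33's `B3Op116MajorantConvolution.majorant_le_top`, p35 gen 22's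
`B3Op116DKernelRegularTorus.W_apply_eq_op116_one_zero` ((I.3.44) read from the left).

## What is printed

[B3] p. 414 [PDF 4] (verbatim): *"[G_k(Ω,B̃)V_k(Ã,B̃)]^n G_k(Ω,Ã+B̃) [V_k(Ã,B̃)G_k(Ω,B̃)]^{n′}, (1.16) … for n, n′ sufficiently large, a kernel
of the operator (1.16) is a sufficiently regular function of both variables. More exactly the Hölder norms of the covariant derivatives of
this kernel, the norms defined for example in the inequalities (I.2.24) and (I.2.25) of Proposition I.2.1, are exponentially decaying with
the distance of the arguments and are uniformly bounded by O(1)(e(L^kε)^{1−α})^{n+n′}, where α > 0 but can be arbitrarily small."*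
[B1] p. 619 (3.44) [PDF 17]: *"G_k(Ω,A+B) = G_k(Ω,B) + G_k(Ω,B)[…]G_k(Ω,A+B)"* (the square bracket `= V_k`, p. 620).

## What this file proves, and how

For `n = 0` the outer factor of (1.16) is `G_k(T,Ã+B̃)`, while p40's binder `hH` transports and differentiates with `B̃`; FILE 4γ therefore
stopped at `n ≥ 1`.  No transport split and no (2.11) member of `G_k(T,Ã+B̃)` is needed: by (I.3.44) read from the left,
`(1.16)_{0,n′+1}e = G_k(T,Ã+B̃)·χ = G_k(T,B̃)·χ + G_k(T,B̃)V_k·G_k(T,Ã+B̃)·χ = G_k(T,B̃)V_k·w + (1.16)_{1,n′+1}e`, where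
`χ = (V_kG_k(T,B̃))^{n′+1}e` and `w = G_k(T,B̃)(V_kG_k(T,B̃))^{n′}e` is the PURE-`B̃` CHAIN — in FILE 4β₂'s state `n′` by `base_state` and
`step_state` at `X = B̃` (§1 `state_chainB`).  §2: the split as a field identity (`op116_eq_iterate`, `op116_zero_succ_split`).  §3: FILE 4γ's
Hölder row for an ARBITRARY inner family in the state `J` (`holder_row_family_le` — 4γ's §3 argument verbatim with the inner field
abstracted: `norm_holT_G_srcV_le` + `row_le_of_kernel_le_add` + `row_step_le` at `a_K = 1 − α` + `majorant_le_top`).  §4 **`kernel116_holder_le_zero_left`**: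
the sum of §3 at `J = n′` (the chain) and 4γ's `kernel116_holder_le 0 (n′+1)`, with the common (smaller) rate `δ_{n′+2}`; the packaged form
`kernel116_holder_le_zero_left'` with ONE constant `(holC(n′) + holC(n′+1))·(L^kε)^{n′+1}` under `L^kε ≤ 1` is p40's `hH` at `(0, n′+1)`
(`C_H·t^{0+(n′+1)}` with `t ≥ L^kε`).  Threshold `d < 1 + (n′+1) − α`, i.e. total `M = n′+1` factors `V_k` exactly as 4γ's `d < 1 + M − α`.

## Honest scope

Torus only; same hypotheses as FILE 4γ (the (2.10) bounds `Ineq210 δ₁ C` of `G_k(T,B̃)` and `G_k(T,Ã+B̃)`, the (2.11) row `h211` of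
`G_k(T,B̃)` with `cH`, `sup_b|Ã_b| ≤ s`, `Ã` regular with `δ_A`, `α < 1`, `m² > 0`, `a > 0`, `1 ≤ k ≤ K`); `n′ = 0` with `n = 0` (no `V_k`
at all: the kernel of `G_k(T,Ã+B̃)` itself) is below every threshold and not a case of print's sentence.  Constants explicit, not
simplified.  Theorems only: no `def`, no `def … : Prop`, no new named fact; axioms standard.  Value = located engine of a by-reference step
of B3, NOT summit progress.
-/

noncomputable section

open scoped BigOperators

namespace Literature.MathematicalPhysics.QuantumFieldTheory.Balaban1983to89.B3Op116HolderKernelRegularTorusZero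

open HiggsLattice (ChargeData ScalarField covDeriv)
open HiggsCovariance (propagatorK E)
open HiggsAveraging (blockK blockIter)
open B1Eq230FluctCov (Ix cb)
open B1TorusChainTransport (hol)
open B3Ineq211RegularTorus (IsAdm)
open B3Ineq210RegularRegion (regRegionKernels)
open B3Op116SourceForm (srcV avgSrc covDerivAt op116_zero_zero_apply op116_succ_left_apply op116_succ_right_apply)
open B3Op116KernelRegularTorus (norm_mapE_avgSrc_le_block)
open B3Op116MajorantStep (maj maj_nonneg maj_rate_mono stepC stepC_nonneg row_step_le)
open B3Op116DKernelRegularTorus (step_state base_state rateAt cvAt cdAt seqC_pos seqC_succ kap4 kap4_nonneg cK1 cK1_ge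
  W_apply_eq_op116_one_zero)
open B3Op116MajorantConvolution (majorant_le_top)
open B3Op116HolderKernelRegularTorus (holT holT_apply hcol holC norm_holT_G_srcV_le row_le_of_kernel_le_add mesh_rpow_split_holder
  exp_add_exp_le_two_exp_min kernel116_holder_le)
open B3Eq116TwoSidedExpansion (op116)

variable {P : HiggsLattice.Params} {N : ℕ}

/-! ## §1 The pure-`B̃` chain `G_k(T,B̃)(V_kG_k(T,B̃))^m` in FILE 4β₂'s state -/

section Chain

variable {C : ChargeData N} {A B : HiggsLattice.VecField P 0} {msq a : ℝ} {k K₀ : ℕ} {hL1 : 1 < P.L} {δ₁ Cst s δA δ₀ cv₀ cd₀ : ℝ}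

variable (hδ₁ : 0 < δ₁) (hδ₁1 : δ₁ ≤ 1) (hCst : 0 ≤ Cst)
  (h210B : (regRegionKernels hL1 C Finset.univ B msq a k K₀).Ineq210 δ₁ Cst)
  (h210AB : (regRegionKernels hL1 C Finset.univ (A + B) msq a k K₀).Ineq210 δ₁ Cst)
  (hmsq : 0 < msq) (ha : 0 < a) (hk : 1 ≤ k) (hkK : k ≤ P.K) (i₀ : Ix N)
  (hs : 0 ≤ s) (hA : ∀ b : HiggsLattice.PBond P 0, |A b| ≤ s) (hδA : 0 ≤ δA)
  (hregA : ∀ (z : HiggsLattice.Site P 0) (μ ν : Fin P.d), |A ⟨z.shift ν, μ⟩ - A ⟨z, μ⟩| ≤ δA)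
  (hδ₀ : 0 < δ₀) (hδ₀1 : δ₀ ≤ δ₁) (hcv₀ : 0 ≤ cv₀) (hcd₀ : 0 ≤ cd₀)
  (x' : HiggsLattice.Site P 0)
include hδ₁ hδ₁1 hCst h210B h210AB hmsq ha hk hkK i₀ hs hA hδA hregA hδ₀ hδ₀1 hcv₀ hcd₀

/-- **THE PURE-`B̃` CHAIN IN THE STATE**: if `G_k(T,B̃)φ` is in the state `J`, then `G_k(T,B̃)(V_kG_k(T,B̃))^mφ` is in the state `J + m`
(FILE 4β₂'s `step_state` at `X = B̃`, iterated; the source map `φ ↦ V_kG_k(T,B̃)φ` written as `Function.iterate`).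
[cite: Balaban1983Higgs3, (1.16) p.414, (2.10) p.426] -/
theorem state_chainB : ∀ (m J : ℕ) (φ : ScalarField P 0 N),
    ((∀ y, ‖propagatorK C Finset.univ B msq a k φ y‖
          ≤ maj P k (cvAt P N C k a Cst s δA δ₀ cv₀ cd₀ J) (2 + (J : ℝ)) (rateAt P N C k a Cst s δA δ₀ cv₀ cd₀ J) y x') ∧
      (∀ b₀, ‖covDeriv C B (propagatorK C Finset.univ B msq a k φ) b₀‖
          ≤ maj P k (cdAt P N C k a Cst s δA δ₀ cv₀ cd₀ J) (1 + (J : ℝ)) (rateAt P N C k a Cst s δA δ₀ cv₀ cd₀ J) b₀.src x')) →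
    (∀ y, ‖propagatorK C Finset.univ B msq a k
          ((fun ψ => srcV C A B k Finset.univ a (propagatorK C Finset.univ B msq a k ψ))^[m] φ) y‖
        ≤ maj P k (cvAt P N C k a Cst s δA δ₀ cv₀ cd₀ (J + m)) (2 + ((J + m : ℕ) : ℝ))
            (rateAt P N C k a Cst s δA δ₀ cv₀ cd₀ (J + m)) y x') ∧
    (∀ b₀, ‖covDeriv C B (propagatorK C Finset.univ B msq a k
          ((fun ψ => srcV C A B k Finset.univ a (propagatorK C Finset.univ B msq a k ψ))^[m] φ)) b₀‖
        ≤ maj P k (cdAt P N C k a Cst s δA δ₀ cv₀ cd₀ (J + m)) (1 + ((J + m : ℕ) : ℝ))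
            (rateAt P N C k a Cst s δA δ₀ cv₀ cd₀ (J + m)) b₀.src x') := by
  intro m
  induction m with
  | zero =>
    intro J φ hφ
    simp only [Function.iterate_zero, id_eq, Nat.add_zero]
    exact hφ
  | succ m ih =>
    intro J φ hφ
    -- one step at `X = B̃`: `G_B(V_kG_Bφ)` is in the state `J + 1`
    have h1 := step_state hδ₁ hδ₁1 hCst h210B h210AB hmsq ha hk hkK i₀ hs hA hδA hregA hδ₀ hδ₀1 hcv₀ hcd₀ x' J
      (propagatorK C Finset.univ B msq a k φ) hφ.1 hφ.2 B (Or.inl rfl)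
    have h := ih (J + 1) (srcV C A B k Finset.univ a (propagatorK C Finset.univ B msq a k φ)) h1
    have e : J + (m + 1) = J + 1 + m := by omega
    rw [e, Function.iterate_succ_apply]
    exact h

end Chain

/-! ## §2 The (I.3.44) split of `(1.16)_{0,n′+1}` as a field identity -/

section Split

variable (C : ChargeData N) (Ω : Finset (HiggsLattice.Site P 0)) (A B : HiggsLattice.VecField P 0) (msq a : ℝ) (k : ℕ)

/-- peeling all right factors: `(1.16)_{n,m}φ = (1.16)_{n,0}((V_kG_k(Ω,B̃))^mφ)`. [cite: Balaban1983Higgs3, (1.16) p.414] -/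
theorem op116_eq_iterate (n : ℕ) : ∀ (m : ℕ) (φ : ScalarField P 0 N),
    op116 C Ω A B msq a k n m φ
      = op116 C Ω A B msq a k n 0 ((fun ψ => srcV C A B k Ω a (propagatorK C Ω B msq a k ψ))^[m] φ) := by
  intro m
  induction m with
  | zero => intro φ; simp only [Function.iterate_zero, id_eq]
  | succ m ih =>
    intro φ
    rw [op116_succ_right_apply, ih, Function.iterate_succ_apply]

variable {C A B msq a k}

/-- **THE SPLIT**: `(1.16)_{0,n′+1}φ = G_k(T,B̃)V_k·[G_k(T,B̃)(V_kG_k(T,B̃))^{n′}φ] + (1.16)_{1,n′+1}φ` on the torus, from (I.3.44) read from the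
left (`G_{A+B} − G_B = G_BV_kG_{A+B}`, `W_apply_eq_op116_one_zero`; `m² > 0`, `a > 0`, `k ≥ 1`, `L > 1`).
[cite: Balaban1982Higgs1, (3.44) p.619] [cite: Balaban1983Higgs3, (1.16) p.414] -/
theorem op116_zero_succ_split (hL : 1 < P.L) (hmsq : 0 < msq) (ha : 0 < a) (hk : 1 ≤ k) (n' : ℕ) (φ : ScalarField P 0 N) :
    op116 C Finset.univ A B msq a k 0 (n' + 1) φ
      = propagatorK C Finset.univ B msq a k (srcV C A B k Finset.univ a
          (propagatorK C Finset.univ B msq a k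
            ((fun ψ => srcV C A B k Finset.univ a (propagatorK C Finset.univ B msq a k ψ))^[n'] φ)))
        + op116 C Finset.univ A B msq a k 1 (n' + 1) φ := by
  set f : ScalarField P 0 N → ScalarField P 0 N :=
    fun ψ => srcV C A B k Finset.univ a (propagatorK C Finset.univ B msq a k ψ) with hf
  have h0 : op116 C Finset.univ A B msq a k 0 (n' + 1) φ = propagatorK C Finset.univ (A + B) msq a k (f^[n' + 1] φ) := by
    rw [op116_eq_iterate, op116_zero_zero_apply]
  have h1 : op116 C Finset.univ A B msq a k 1 (n' + 1) φ = op116 C Finset.univ A B msq a k 1 0 (f^[n' + 1] φ) := by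
    rw [op116_eq_iterate]
  have hW := W_apply_eq_op116_one_zero (C := C) (A := A) (B := B) (msq := msq) (a := a) (k := k) hL hmsq ha hk (f^[n' + 1] φ)
  rw [LinearMap.sub_apply] at hW
  have hsucc : f^[n' + 1] φ = f (f^[n'] φ) := Function.iterate_succ_apply' f n' φ
  rw [h0, h1, ← hW]
  have hG : propagatorK C Finset.univ B msq a k (f^[n' + 1] φ)
      = propagatorK C Finset.univ B msq a k (srcV C A B k Finset.univ a (propagatorK C Finset.univ B msq a k (f^[n'] φ))) := by
    rw [hsucc]
  rw [← hG]
  abel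

end Split

/-! ## §3 FILE 4γ's Hölder row for an arbitrary inner family in the state `J` -/

section Row

variable {C : ChargeData N} {A B : HiggsLattice.VecField P 0} {msq a : ℝ} {k K₀ : ℕ} {hL1 : 1 < P.L} {δ₁ Cst s δA α cH : ℝ}

variable (hδ₁ : 0 < δ₁) (hδ₁1 : δ₁ ≤ 1) (hCst : 0 ≤ Cst)
  (h210B : (regRegionKernels hL1 C Finset.univ B msq a k K₀).Ineq210 δ₁ Cst)
  (h210AB : (regRegionKernels hL1 C Finset.univ (A + B) msq a k K₀).Ineq210 δ₁ Cst)
  (hmsq : 0 < msq) (ha : 0 < a) (hk : 1 ≤ k) (hkK : k ≤ P.K) (i₀ : Ix N)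
  (hs : 0 ≤ s) (hA : ∀ b : HiggsLattice.PBond P 0, |A b| ≤ s) (hδA : 0 ≤ δA)
  (hregA : ∀ (z : HiggsLattice.Site P 0) (μ ν : Fin P.d), |A ⟨z.shift ν, μ⟩ - A ⟨z, μ⟩| ≤ δA)
  (hα1 : α < 1) (hcH : 0 ≤ cH)
  (h211 : ∀ (μ : Fin P.d) (x₁ x₂ y : HiggsLattice.Site P 0), x₁ ≠ x₂ → ∀ Γ : List (HiggsLattice.Site P 0), IsAdm x₁ x₂ Γ →
    (∑ i : Ix N, ‖hol C B x₁ Γ (covDeriv C B (propagatorK C Finset.univ B msq a k (cb P N 0 (y, i))) ⟨x₂, μ⟩)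
        - covDeriv C B (propagatorK C Finset.univ B msq a k (cb P N 0 (y, i))) ⟨x₁, μ⟩‖)
        / (P.mesh 0 * (HiggsLattice.Site.tdist x₁ x₂ : ℝ)) ^ α
      ≤ ∑ j ∈ Finset.range k, cH * P.mesh j ^ (((1 : ℝ) - α) - (P.d : ℝ)) *
          (Real.exp (-(δ₁ * (P.mesh j)⁻¹ * (P.mesh 0 * (HiggsLattice.Site.tdist x₁ y : ℝ)))) +
            Real.exp (-(δ₁ * (P.mesh j)⁻¹ * (P.mesh 0 * (HiggsLattice.Site.tdist x₂ y : ℝ))))))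
include hδ₁ hδ₁1 hCst h210B h210AB hmsq ha hk hkK i₀ hs hA hδA hregA hα1 hcH h211

omit h210B h210AB hmsq ha in
/-- **THE HÖLDER ROW OF `G_k(T,B̃)V_k` ON A FAMILY IN THE STATE `J`** (FILE 4γ's §3 argument with the inner field abstracted): if every
`w_{i′}` satisfies `‖w_{i′}(y)‖ ≤ 𝔪_k(cvAt J, 2+J; δ_J)(y,x′)` and `‖(D^ε_{B̃}w_{i′})(b)‖ ≤ 𝔪_k(cdAt J, 1+J; δ_J)(b₋,x′)` (the state `J` of the
unit triple), then for `d < 1 + (J+1) − α`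
`ε^{−d}Σ_{i′}‖U(B̃(Γ))(D^ε_{B̃}G_k(T,B̃)V_kw_{i′})(⟨x₂,μ⟩) − (D^ε_{B̃}G_k(T,B̃)V_kw_{i′})(⟨x₁,μ⟩)‖
≤ (ε|x₁−x₂|)^α·holC(J)·(L^kε)^{J+1}·((L^kε)((L^kε)^d)^{−1}((L^kε)^α)^{−1})·exp(−δ_{J+1}·min(|x₁−x′|,|x₂−x′|)/L^k)`.
[cite: Balaban1983Higgs3, (1.16) p.414, (2.5) p.424, (2.11) p.426] [cite: Balaban1982Higgs1, Prop. 2.1 (2.24) p.610, (3.16) p.615] -/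
theorem holder_row_family_le (hL : 1 < P.L) (J : ℕ) (hd : (P.d : ℝ) < 1 + ((J + 1 : ℕ) : ℝ) - α) (μ : Fin P.d)
    (x₁ x₂ x' : HiggsLattice.Site P 0) (hne : x₁ ≠ x₂) (Γ : List (HiggsLattice.Site P 0)) (hΓ : IsAdm x₁ x₂ Γ)
    (W : Ix N → ScalarField P 0 N)
    (hW : ∀ i' : Ix N,
      (∀ y, ‖W i' y‖ ≤ maj P k (cvAt P N C k a Cst s δA δ₁ (P.mesh 0 ^ P.d * Cst) (cK1 P C k Cst s) J) (2 + (J : ℝ))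
          (rateAt P N C k a Cst s δA δ₁ (P.mesh 0 ^ P.d * Cst) (cK1 P C k Cst s) J) y x') ∧
      (∀ b, ‖covDeriv C B (W i') b‖ ≤ maj P k (cdAt P N C k a Cst s δA δ₁ (P.mesh 0 ^ P.d * Cst) (cK1 P C k Cst s) J) (1 + (J : ℝ))
          (rateAt P N C k a Cst s δA δ₁ (P.mesh 0 ^ P.d * Cst) (cK1 P C k Cst s) J) b.src x')) :
    (P.mesh 0 ^ P.d)⁻¹ * ∑ i' : Ix N,
        ‖holT C B x₁ x₂ Γ μ (propagatorK C Finset.univ B msq a k (srcV C A B k Finset.univ a (W i')))‖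
      ≤ (P.mesh 0 * (HiggsLattice.Site.tdist x₁ x₂ : ℝ)) ^ α *
          (holC P N C k a δ₁ Cst s δA α cH J * P.mesh k ^ (J + 1) *
            (P.mesh k * (P.mesh k ^ P.d)⁻¹ * (P.mesh k ^ α)⁻¹)) *
          Real.exp (-(rateAt P N C k a Cst s δA δ₁ (P.mesh 0 ^ P.d * Cst) (cK1 P C k Cst s) (J + 1) *
            (min (HiggsLattice.Site.tdist x₁ x' : ℝ) (HiggsLattice.Site.tdist x₂ x' : ℝ) / (P.L : ℝ) ^ k))) := by
  have hL1' : (1 : ℝ) < (P.L : ℝ) := by exact_mod_cast hL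
  have hc : 0 ≤ P.mesh 0 ^ P.d * Cst := mul_nonneg (pow_nonneg (P.mesh_pos 0).le _) hCst
  obtain ⟨-, hcK1⟩ := cK1_ge (P := P) (C := C) (k := k) hCst hs
  obtain ⟨hr0, hrδ, hcv0, hcd0⟩ := seqC_pos (P := P) (N := N) (C := C) (k := k) (a := a) (Cst := Cst) (s := s) (δA := δA)
    (δ₀ := δ₁) (cv₀ := P.mesh 0 ^ P.d * Cst) (cd₀ := cK1 P C k Cst s) hL hδ₁ le_rfl hc hcK1 hCst hs hδA J
  have hes : 0 ≤ |C.e| * s := mul_nonneg (abs_nonneg _) hs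
  have hκ₂ : 0 ≤ (P.mesh 0)⁻¹ * (|C.e| * δA) := mul_nonneg (inv_nonneg.mpr (P.mesh_pos 0).le) (mul_nonneg (abs_nonneg _) hδA)
  have hκ₄ : 0 ≤ kap4 P C k a s := kap4_nonneg hs
  have hca : 0 ≤ |B1.aSeq a P.L k| * (P.mesh k)⁻¹ ^ 2 := by positivity
  have haK : 0 < 1 - α := by linarith
  have hav : (1 : ℝ) < 2 + (J : ℝ) := by have := (Nat.cast_nonneg J : (0:ℝ) ≤ J); linarith
  have hε : 0 ≤ (P.mesh 0 ^ P.d)⁻¹ := inv_nonneg.mpr (pow_nonneg (P.mesh_pos 0).le _)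
  -- the Hölder prefactor
  set q : ℝ := (P.mesh 0 * (HiggsLattice.Site.tdist x₁ x₂ : ℝ)) ^ α with hq
  have ht12 : 0 < P.mesh 0 * (HiggsLattice.Site.tdist x₁ x₂ : ℝ) := by
    have h1 : (1 : ℝ) ≤ (HiggsLattice.Site.tdist x₁ x₂ : ℝ) := by
      exact_mod_cast B3Ineq211RegularTorus.one_le_tdist_of_ne' (Ne.symm hne)
    have := P.mesh_pos 0
    positivity
  have hq0 : 0 < q := Real.rpow_pos_of_pos ht12 α
  -- the two one-anchor majorants of the Hölder column, at the rate of the state J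
  set δJ := rateAt P N C k a Cst s δA δ₁ (P.mesh 0 ^ P.d * Cst) (cK1 P C k Cst s) J with hδJ
  set M₁ : HiggsLattice.Site P 0 → ℝ := fun y => maj P k cH (1 - α) δJ x₁ y with hM₁
  set M₂ : HiggsLattice.Site P 0 → ℝ := fun y => maj P k cH (1 - α) δJ x₂ y with hM₂
  set K : HiggsLattice.Site P 0 → ℝ := fun y => hcol C B msq a k x₁ x₂ Γ μ y with hK
  have hKle : ∀ y, K y ≤ q * (M₁ y + M₂ y) := by
    intro y
    have h := h211 μ x₁ x₂ y hne Γ hΓ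
    rw [div_le_iff₀ hq0] at h
    have hsplit : (∑ j ∈ Finset.range k, cH * P.mesh j ^ (((1 : ℝ) - α) - (P.d : ℝ)) *
          (Real.exp (-(δ₁ * (P.mesh j)⁻¹ * (P.mesh 0 * (HiggsLattice.Site.tdist x₁ y : ℝ)))) +
            Real.exp (-(δ₁ * (P.mesh j)⁻¹ * (P.mesh 0 * (HiggsLattice.Site.tdist x₂ y : ℝ))))))
        = maj P k cH (1 - α) δ₁ x₁ y + maj P k cH (1 - α) δ₁ x₂ y := by
      unfold maj
      rw [← Finset.sum_add_distrib]
      exact Finset.sum_congr rfl fun j _ => by ring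
    rw [hsplit] at h
    have h1 : maj P k cH (1 - α) δ₁ x₁ y ≤ M₁ y := maj_rate_mono hcH hrδ x₁ y
    have h2 : maj P k cH (1 - α) δ₁ x₂ y ≤ M₂ y := maj_rate_mono hcH hrδ x₂ y
    calc K y = hcol C B msq a k x₁ x₂ Γ μ y := rfl
      _ ≤ (maj P k cH (1 - α) δ₁ x₁ y + maj P k cH (1 - α) δ₁ x₂ y) * q := h
      _ ≤ (M₁ y + M₂ y) * q := mul_le_mul_of_nonneg_right (add_le_add h1 h2) hq0.le
      _ = q * (M₁ y + M₂ y) := mul_comm _ _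
  -- the per-i′ bound
  have hpt : ∀ i' : Ix N,
      ‖holT C B x₁ x₂ Γ μ (propagatorK C Finset.univ B msq a k (srcV C A B k Finset.univ a (W i')))‖
        ≤ q * (maj P k (stepC P N k δJ (1 - α) (2 + (J : ℝ)) cH (cvAt P N C k a Cst s δA δ₁ (P.mesh 0 ^ P.d * Cst) (cK1 P C k Cst s) J) (cdAt P N C k a Cst s δA δ₁ (P.mesh 0 ^ P.d * Cst) (cK1 P C k Cst s) J)
              (|C.e| * s) ((P.mesh 0)⁻¹ * (|C.e| * δA)) ((|C.e| * s) ^ 2) (kap4 P C k a s))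
              ((1 - α) + (2 + (J : ℝ)) - 1) (δJ / 2 / P.L / 2) x₁ x'
          + maj P k (stepC P N k δJ (1 - α) (2 + (J : ℝ)) cH (cvAt P N C k a Cst s δA δ₁ (P.mesh 0 ^ P.d * Cst) (cK1 P C k Cst s) J) (cdAt P N C k a Cst s δA δ₁ (P.mesh 0 ^ P.d * Cst) (cK1 P C k Cst s) J)
              (|C.e| * s) ((P.mesh 0)⁻¹ * (|C.e| * δA)) ((|C.e| * s) ^ 2) (kap4 P C k a s))
              ((1 - α) + (2 + (J : ℝ)) - 1) (δJ / 2 / P.L / 2) x₂ x') := by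
    intro i'
    set w := W i' with hw
    obtain ⟨hV, hD⟩ := hW i'
    have hD' : ∀ b, ‖covDeriv C B w b‖ ≤ maj P k (cdAt P N C k a Cst s δA δ₁ (P.mesh 0 ^ P.d * Cst) (cK1 P C k Cst s) J) (2 + (J : ℝ) - 1) δJ b.src x' := by
      intro b; rw [show (2 : ℝ) + (J : ℝ) - 1 = 1 + (J : ℝ) by ring]; exact hD b
    -- the Hölder row
    have hrow := norm_holT_G_srcV_le (C := C) (B := B) (msq := msq) (a := a) (k := k) A hA hregA x₁ x₂ Γ μ w
    -- the averaging source through the Hölder functional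
    set T : ScalarField P 0 N →ₗ[ℝ] E N :=
      holT C B x₁ x₂ Γ μ ∘ₗ (propagatorK C Finset.univ B msq a k : ScalarField P 0 N →ₗ[ℝ] ScalarField P 0 N) with hT
    have hT' : ∀ φ : ScalarField P 0 N, T φ = holT C B x₁ x₂ Γ μ (propagatorK C Finset.univ B msq a k φ) := fun φ => rfl
    have havg := norm_mapE_avgSrc_le_block (C := C) (A := A) (B := B) (k := k) T hkK hs hA w
    have hcolT : ∀ z, ∑ i : Ix N, ‖T (cb P N 0 (z, i))‖ = K z := fun z => by simp only [hT', hK]; rfl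
    simp only [hcolT] at havg
    rw [hT'] at havg
    -- the full row at the kernel K
    have hR : ‖holT C B x₁ x₂ Γ μ (propagatorK C Finset.univ B msq a k (srcV C A B k Finset.univ a w))‖
        ≤ (∑ b : HiggsLattice.PBond P 0,
            (|C.e| * s * ‖covDeriv C B w b‖ * K b.tgt
              + ((P.mesh 0)⁻¹ * (|C.e| * δA) * ‖w b.src‖ + |C.e| * s * ‖covDeriv C B w b‖) * K b.src
              + (|C.e| * s) ^ 2 * ‖w b.tgt‖ * K b.tgt))
          + kap4 P C k a s * ∑ z : HiggsLattice.Site P 0, K z *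
              (((P.L : ℝ) ^ (k * P.d))⁻¹ * ∑ u ∈ blockK k (blockIter k z), ‖w u‖) := by
      refine hrow.trans (add_le_add le_rfl ?_)
      refine (mul_le_mul_of_nonneg_left havg hca).trans (le_of_eq ?_)
      rw [kap4, Finset.mul_sum, Finset.mul_sum]
      exact Finset.sum_congr rfl fun z _ => by ring
    -- split the kernel into the two anchors
    have hsplit := row_le_of_kernel_le_add (k := k) hes hκ₂ (sq_nonneg (|C.e| * s)) hκ₄ K M₁ M₂ hKle
      (fun y => ‖w y‖) (fun y => norm_nonneg _) (fun b => ‖covDeriv C B w b‖) (fun b => norm_nonneg _)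
    -- each anchor: one step with a_K = 1 − α
    have hstep := fun (p : HiggsLattice.Site P 0) =>
      row_step_le (N := N) hL hk hkK hr0 (hrδ.trans hδ₁1) haK hav hcH hcv0 hcd0 hes hκ₂ (sq_nonneg (|C.e| * s)) hκ₄ i₀ p x'
        (fun y => maj P k cH (1 - α) δJ p y) (fun y => maj_nonneg hcH p y) (fun y => le_rfl)
        (fun y => ‖w y‖) (fun y => norm_nonneg _) hV (fun b => ‖covDeriv C B w b‖) (fun b => norm_nonneg _) hD'
    exact hR.trans (hsplit.trans (mul_le_mul_of_nonneg_left (add_le_add (hstep x₁) (hstep x₂)) hq0.le))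
  -- top-scale domination of the two majorants and assembly
  set cS := stepC P N k δJ (1 - α) (2 + (J : ℝ)) cH (cvAt P N C k a Cst s δA δ₁ (P.mesh 0 ^ P.d * Cst) (cK1 P C k Cst s) J) (cdAt P N C k a Cst s δA δ₁ (P.mesh 0 ^ P.d * Cst) (cK1 P C k Cst s) J)
    (|C.e| * s) ((P.mesh 0)⁻¹ * (|C.e| * δA)) ((|C.e| * s) ^ 2) (kap4 P C k a s) with hcS
  have hcS0 : 0 ≤ cS := stepC_nonneg hL k hr0 haK hav hcH hcv0 hcd0 hes hκ₂ (sq_nonneg _) hκ₄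
  have hsM : 0 < (1 - α) + (2 + (J : ℝ)) - 1 - (P.d : ℝ) := by
    push_cast at hd ⊢; linarith
  set δ' := δJ / 2 / P.L / 2 with hδ'
  have hδ'0 : 0 ≤ δ' := by rw [hδ']; positivity
  have hδ'eq : rateAt P N C k a Cst s δA δ₁ (P.mesh 0 ^ P.d * Cst) (cK1 P C k Cst s) (J + 1) = δ' := by
    rw [hδ', hδJ]
    exact (seqC_succ (P := P) (N := N) (C := C) (k := k) (a := a) (Cst := Cst) (s := s) (δA := δA) (δ₀ := δ₁)
      (cv₀ := P.mesh 0 ^ P.d * Cst) (cd₀ := cK1 P C k Cst s) J).1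
  have htop : ∀ p : HiggsLattice.Site P 0, maj P k cS ((1 - α) + (2 + (J : ℝ)) - 1) δ' p x'
      ≤ cS / ((P.L : ℝ) ^ ((1 - α) + (2 + (J : ℝ)) - 1 - (P.d : ℝ)) - 1) * P.mesh k ^ ((1 - α) + (2 + (J : ℝ)) - 1 - (P.d : ℝ)) *
          Real.exp (-(δ' * (P.mesh k)⁻¹ * (P.mesh 0 * (HiggsLattice.Site.tdist p x' : ℝ)))) := by
    intro p
    unfold maj
    exact majorant_le_top hL hcS0 hsM hδ'0 p x'
  have hexp : (1 - α) + (2 + (J : ℝ)) - 1 - (P.d : ℝ) = (1 : ℝ) + ((J + 1 : ℕ) : ℝ) - α - (P.d : ℝ) := by push_cast; ring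
  have hgeom : 0 < (P.L : ℝ) ^ ((1 : ℝ) + ((J + 1 : ℕ) : ℝ) - α - (P.d : ℝ)) - 1 := by
    have : (1 : ℝ) < (P.L : ℝ) ^ ((1 : ℝ) + ((J + 1 : ℕ) : ℝ) - α - (P.d : ℝ)) := Real.one_lt_rpow hL1' (by rw [← hexp]; exact hsM)
    linarith
  set Z : ℝ := cS / ((P.L : ℝ) ^ ((1 : ℝ) + ((J + 1 : ℕ) : ℝ) - α - (P.d : ℝ)) - 1) *
    (P.mesh k ^ (J + 1) * (P.mesh k * (P.mesh k ^ P.d)⁻¹ * (P.mesh k ^ α)⁻¹)) with hZ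
  have hZ0 : 0 ≤ Z := by
    have := P.mesh_pos k
    rw [hZ]; positivity
  have htop' : ∀ p : HiggsLattice.Site P 0, maj P k cS ((1 - α) + (2 + (J : ℝ)) - 1) δ' p x'
      ≤ Z * Real.exp (-(δ' * ((HiggsLattice.Site.tdist p x' : ℝ) / (P.L : ℝ) ^ k))) := by
    intro p
    refine (htop p).trans (le_of_eq ?_)
    rw [hexp, mesh_rpow_split_holder, B3Op116DKernelRegularTorus.rate_div_eq, hZ]
  have hLk : (0 : ℝ) < (P.L : ℝ) ^ k := by positivity
  have hsum2 := exp_add_exp_le_two_exp_min hδ'0 hLk (HiggsLattice.Site.tdist x₁ x' : ℝ) (HiggsLattice.Site.tdist x₂ x' : ℝ)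
  calc (P.mesh 0 ^ P.d)⁻¹ * ∑ i' : Ix N,
        ‖holT C B x₁ x₂ Γ μ (propagatorK C Finset.univ B msq a k (srcV C A B k Finset.univ a (W i')))‖
      ≤ (P.mesh 0 ^ P.d)⁻¹ * ∑ _i' : Ix N, q * (Z * Real.exp (-(δ' * ((HiggsLattice.Site.tdist x₁ x' : ℝ) / (P.L : ℝ) ^ k)))
          + Z * Real.exp (-(δ' * ((HiggsLattice.Site.tdist x₂ x' : ℝ) / (P.L : ℝ) ^ k)))) := by
        refine mul_le_mul_of_nonneg_left (Finset.sum_le_sum fun i' _ => (hpt i').trans ?_) hε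
        exact mul_le_mul_of_nonneg_left (add_le_add (htop' x₁) (htop' x₂)) hq0.le
    _ = q * ((P.mesh 0 ^ P.d)⁻¹ * (Fintype.card (Ix N) : ℝ) * Z) *
          (Real.exp (-(δ' * ((HiggsLattice.Site.tdist x₁ x' : ℝ) / (P.L : ℝ) ^ k)))
            + Real.exp (-(δ' * ((HiggsLattice.Site.tdist x₂ x' : ℝ) / (P.L : ℝ) ^ k)))) := by
        rw [Finset.sum_const, Finset.card_univ, nsmul_eq_mul]; ring
    _ ≤ q * ((P.mesh 0 ^ P.d)⁻¹ * (Fintype.card (Ix N) : ℝ) * Z) *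
          (2 * Real.exp (-(δ' * (min (HiggsLattice.Site.tdist x₁ x' : ℝ) (HiggsLattice.Site.tdist x₂ x' : ℝ) / (P.L : ℝ) ^ k)))) :=
        mul_le_mul_of_nonneg_left hsum2 (by positivity)
    _ = _ := by
        rw [hδ'eq, holC, hZ, hq]
        ring

end Row

/-! ## §4 The Hölder clause of the kernel of (1.16) at `n = 0` on the torus -/

section Zero

variable {C : ChargeData N} {A B : HiggsLattice.VecField P 0} {msq a : ℝ} {k K₀ : ℕ} {hL1 : 1 < P.L} {δ₁ Cst s δA α cH : ℝ}

variable (hδ₁ : 0 < δ₁) (hδ₁1 : δ₁ ≤ 1) (hCst : 0 ≤ Cst)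
  (h210B : (regRegionKernels hL1 C Finset.univ B msq a k K₀).Ineq210 δ₁ Cst)
  (h210AB : (regRegionKernels hL1 C Finset.univ (A + B) msq a k K₀).Ineq210 δ₁ Cst)
  (hmsq : 0 < msq) (ha : 0 < a) (hk : 1 ≤ k) (hkK : k ≤ P.K) (i₀ : Ix N)
  (hs : 0 ≤ s) (hA : ∀ b : HiggsLattice.PBond P 0, |A b| ≤ s) (hδA : 0 ≤ δA)
  (hregA : ∀ (z : HiggsLattice.Site P 0) (μ ν : Fin P.d), |A ⟨z.shift ν, μ⟩ - A ⟨z, μ⟩| ≤ δA)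
  (hα1 : α < 1) (hcH : 0 ≤ cH)
  (h211 : ∀ (μ : Fin P.d) (x₁ x₂ y : HiggsLattice.Site P 0), x₁ ≠ x₂ → ∀ Γ : List (HiggsLattice.Site P 0), IsAdm x₁ x₂ Γ →
    (∑ i : Ix N, ‖hol C B x₁ Γ (covDeriv C B (propagatorK C Finset.univ B msq a k (cb P N 0 (y, i))) ⟨x₂, μ⟩)
        - covDeriv C B (propagatorK C Finset.univ B msq a k (cb P N 0 (y, i))) ⟨x₁, μ⟩‖)
        / (P.mesh 0 * (HiggsLattice.Site.tdist x₁ x₂ : ℝ)) ^ α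
      ≤ ∑ j ∈ Finset.range k, cH * P.mesh j ^ (((1 : ℝ) - α) - (P.d : ℝ)) *
          (Real.exp (-(δ₁ * (P.mesh j)⁻¹ * (P.mesh 0 * (HiggsLattice.Site.tdist x₁ y : ℝ)))) +
            Real.exp (-(δ₁ * (P.mesh j)⁻¹ * (P.mesh 0 * (HiggsLattice.Site.tdist x₂ y : ℝ))))))
include hδ₁ hδ₁1 hCst h210B h210AB hmsq ha hk hkK i₀ hs hA hδA hregA hα1 hcH h211

/-- **THE HÖLDER QUOTIENT OF THE ROW DERIVATIVE OF THE KERNEL OF (1.16) ON THE TORUS AT `n = 0`, FOR ALL `n′ ≥ 1`, `d < 1 + n′ − α`**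
(outer factor `G_k(T,Ã+B̃)`; print's *"the Hölder norms of the covariant derivatives of this kernel … are exponentially decaying … uniformly
bounded"*, p. 414): under the hypotheses of FILE 4γ's `kernel116_holder_le`, for every `n′` with `d < 1 + (n′+1) − α`, direction `μ`, sites
`x₁ ≠ x₂`, `x′`, admissible contour `Γ` from `x₁` to `x₂`:
`ε^{−d}Σ_{i′}‖U(B̃(Γ))(D^ε_{B̃}(1.16)_{0,n′+1}e_{(x′,i′)})(⟨x₂,μ⟩) − (D^ε_{B̃}(1.16)_{0,n′+1}e_{(x′,i′)})(⟨x₁,μ⟩)‖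
≤ (ε|x₁−x₂|)^α·[holC(n′)(L^kε)^{n′+1} + holC(n′+1)(L^kε)^{n′+2}]·((L^kε)((L^kε)^d)^{−1}((L^kε)^α)^{−1})·exp(−δ_{n′+2}·min(|x₁−x′|,|x₂−x′|)/L^k)` —
the two terms of the (I.3.44) split `(1.16)_{0,n′+1} = G_k(T,B̃)V_k·[pure-B̃ chain] + (1.16)_{1,n′+1}` (§3 at `J = n′` and FILE 4γ at
`(0+1, n′+1)`), at the common rate `δ_{n′+2} = δ₁/(4L)^{n′+2}`.
[cite: Balaban1983Higgs3, (1.16) p.414, (2.5) p.424, (2.11) p.426] [cite: Balaban1982Higgs1, Prop. 2.1 (2.24) p.610, (3.44) p.619] -/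
theorem kernel116_holder_le_zero_left (n' : ℕ) (hd : (P.d : ℝ) < 1 + ((n' + 1 : ℕ) : ℝ) - α) (μ : Fin P.d)
    (x₁ x₂ x' : HiggsLattice.Site P 0) (hne : x₁ ≠ x₂) (Γ : List (HiggsLattice.Site P 0)) (hΓ : IsAdm x₁ x₂ Γ) :
    (P.mesh 0 ^ P.d)⁻¹ * ∑ i' : Ix N,
        ‖hol C B x₁ Γ (covDeriv C B (op116 C Finset.univ A B msq a k 0 (n' + 1) (cb P N 0 (x', i'))) ⟨x₂, μ⟩)
          - covDeriv C B (op116 C Finset.univ A B msq a k 0 (n' + 1) (cb P N 0 (x', i'))) ⟨x₁, μ⟩‖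
      ≤ (P.mesh 0 * (HiggsLattice.Site.tdist x₁ x₂ : ℝ)) ^ α *
          ((holC P N C k a δ₁ Cst s δA α cH n' * P.mesh k ^ (n' + 1)
              + holC P N C k a δ₁ Cst s δA α cH (n' + 1) * P.mesh k ^ (n' + 2)) *
            (P.mesh k * (P.mesh k ^ P.d)⁻¹ * (P.mesh k ^ α)⁻¹)) *
          Real.exp (-(rateAt P N C k a Cst s δA δ₁ (P.mesh 0 ^ P.d * Cst) (cK1 P C k Cst s) (n' + 2) *
            (min (HiggsLattice.Site.tdist x₁ x' : ℝ) (HiggsLattice.Site.tdist x₂ x' : ℝ) / (P.L : ℝ) ^ k))) := by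
  have hL : 1 < P.L := hL1
  have hε : 0 ≤ (P.mesh 0 ^ P.d)⁻¹ := inv_nonneg.mpr (pow_nonneg (P.mesh_pos 0).le _)
  have hc : 0 ≤ P.mesh 0 ^ P.d * Cst := mul_nonneg (pow_nonneg (P.mesh_pos 0).le _) hCst
  obtain ⟨-, hcK1⟩ := cK1_ge (P := P) (C := C) (k := k) hCst hs
  -- abbreviations
  set S : ℝ := P.mesh k * (P.mesh k ^ P.d)⁻¹ * (P.mesh k ^ α)⁻¹ with hS
  set q : ℝ := (P.mesh 0 * (HiggsLattice.Site.tdist x₁ x₂ : ℝ)) ^ α with hq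
  set m : ℝ := min (HiggsLattice.Site.tdist x₁ x' : ℝ) (HiggsLattice.Site.tdist x₂ x' : ℝ) / (P.L : ℝ) ^ k with hm
  have hq0 : 0 ≤ q := by rw [hq]; exact Real.rpow_nonneg (mul_nonneg (P.mesh_pos 0).le (Nat.cast_nonneg _)) α
  have hS0 : 0 ≤ S := by have := P.mesh_pos k; rw [hS]; positivity
  have hm0 : 0 ≤ m := by
    rw [hm]; exact div_nonneg (le_min (Nat.cast_nonneg _) (Nat.cast_nonneg _)) (pow_nonneg (Nat.cast_nonneg _) _)
  -- the inner family: the pure-B̃ chain `w_{i′} = G_B(V_kG_B)^{n′}e_{(x′,i′)}` in the state n′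
  set f : ScalarField P 0 N → ScalarField P 0 N :=
    fun ψ => srcV C A B k Finset.univ a (propagatorK C Finset.univ B msq a k ψ) with hf
  set W : Ix N → ScalarField P 0 N := fun i' => propagatorK C Finset.univ B msq a k (f^[n'] (cb P N 0 (x', i'))) with hW
  have hWst : ∀ i' : Ix N,
      (∀ y, ‖W i' y‖ ≤ maj P k (cvAt P N C k a Cst s δA δ₁ (P.mesh 0 ^ P.d * Cst) (cK1 P C k Cst s) n') (2 + (n' : ℝ))
          (rateAt P N C k a Cst s δA δ₁ (P.mesh 0 ^ P.d * Cst) (cK1 P C k Cst s) n') y x') ∧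
      (∀ b, ‖covDeriv C B (W i') b‖ ≤ maj P k (cdAt P N C k a Cst s δA δ₁ (P.mesh 0 ^ P.d * Cst) (cK1 P C k Cst s) n') (1 + (n' : ℝ))
          (rateAt P N C k a Cst s δA δ₁ (P.mesh 0 ^ P.d * Cst) (cK1 P C k Cst s) n') b.src x') := by
    intro i'
    have h0 := base_state (δA := δA) hδ₁ hδ₁1 hCst h210B h210AB hmsq ha hk hkK hs hA x' i' B (Or.inl rfl)
    simp only [Nat.cast_zero, add_zero] at h0
    have h0' : (∀ y, ‖propagatorK C Finset.univ B msq a k (cb P N 0 (x', i')) y‖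
          ≤ maj P k (cvAt P N C k a Cst s δA δ₁ (P.mesh 0 ^ P.d * Cst) (cK1 P C k Cst s) 0) (2 + ((0 : ℕ) : ℝ))
            (rateAt P N C k a Cst s δA δ₁ (P.mesh 0 ^ P.d * Cst) (cK1 P C k Cst s) 0) y x') ∧
        (∀ b₀, ‖covDeriv C B (propagatorK C Finset.univ B msq a k (cb P N 0 (x', i'))) b₀‖
          ≤ maj P k (cdAt P N C k a Cst s δA δ₁ (P.mesh 0 ^ P.d * Cst) (cK1 P C k Cst s) 0) (1 + ((0 : ℕ) : ℝ))
            (rateAt P N C k a Cst s δA δ₁ (P.mesh 0 ^ P.d * Cst) (cK1 P C k Cst s) 0) b₀.src x') := by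
      simp only [Nat.cast_zero, add_zero]; exact h0
    have h := state_chainB hδ₁ hδ₁1 hCst h210B h210AB hmsq ha hk hkK i₀ hs hA hδA hregA hδ₁ le_rfl hc hcK1 x' n' 0 _ h0'
    simp only [Nat.zero_add] at h
    exact h
  -- term 1: the chain through §3
  have h1 := holder_row_family_le hδ₁ hδ₁1 hCst hk hkK i₀ hs hA hδA hregA hα1 hcH h211 hL n' hd μ x₁ x₂ x' hne Γ hΓ W hWst
  -- term 2: FILE 4γ at (0+1, n′+1)
  have hd2 : (P.d : ℝ) < 1 + ((0 + 1 + (n' + 1) : ℕ) : ℝ) - α := by push_cast at hd ⊢; linarith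
  have h2 := kernel116_holder_le hδ₁ hδ₁1 hCst h210B h210AB hmsq ha hk hkK i₀ hs hA hδA hregA hα1 hcH h211 0 (n' + 1) hd2 μ
    x₁ x₂ x' hne Γ hΓ
  have e1 : 0 + (n' + 1) = n' + 1 := by omega
  have e2 : 0 + 1 + (n' + 1) = n' + 2 := by omega
  simp only [e1, e2] at h2
  -- rates: δ_{n′+2} ≤ δ_{n′+1}
  have hrate : rateAt P N C k a Cst s δA δ₁ (P.mesh 0 ^ P.d * Cst) (cK1 P C k Cst s) (n' + 2)
      ≤ rateAt P N C k a Cst s δA δ₁ (P.mesh 0 ^ P.d * Cst) (cK1 P C k Cst s) (n' + 1) := by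
    obtain ⟨hr0, -, -, -⟩ := seqC_pos (P := P) (N := N) (C := C) (k := k) (a := a) (Cst := Cst) (s := s) (δA := δA)
      (δ₀ := δ₁) (cv₀ := P.mesh 0 ^ P.d * Cst) (cd₀ := cK1 P C k Cst s) hL hδ₁ le_rfl hc hcK1 hCst hs hδA (n' + 1)
    rw [show n' + 2 = (n' + 1) + 1 by omega,
      (seqC_succ (P := P) (N := N) (C := C) (k := k) (a := a) (Cst := Cst) (s := s) (δA := δA) (δ₀ := δ₁)
        (cv₀ := P.mesh 0 ^ P.d * Cst) (cd₀ := cK1 P C k Cst s) (n' + 1)).1]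
    have hL1r : (1 : ℝ) ≤ (P.L : ℝ) := by exact_mod_cast P.hL
    rw [div_div, div_div, div_le_iff₀ (by positivity)]
    nlinarith
  have hexp : Real.exp (-(rateAt P N C k a Cst s δA δ₁ (P.mesh 0 ^ P.d * Cst) (cK1 P C k Cst s) (n' + 1) * m))
      ≤ Real.exp (-(rateAt P N C k a Cst s δA δ₁ (P.mesh 0 ^ P.d * Cst) (cK1 P C k Cst s) (n' + 2) * m)) := by
    apply Real.exp_le_exp.mpr
    nlinarith
  -- the split, pointwise in i′
  have hsplit : ∀ i' : Ix N,
      ‖hol C B x₁ Γ (covDeriv C B (op116 C Finset.univ A B msq a k 0 (n' + 1) (cb P N 0 (x', i'))) ⟨x₂, μ⟩)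
          - covDeriv C B (op116 C Finset.univ A B msq a k 0 (n' + 1) (cb P N 0 (x', i'))) ⟨x₁, μ⟩‖
        ≤ ‖holT C B x₁ x₂ Γ μ (propagatorK C Finset.univ B msq a k (srcV C A B k Finset.univ a (W i')))‖
          + ‖hol C B x₁ Γ (covDeriv C B (op116 C Finset.univ A B msq a k 1 (n' + 1) (cb P N 0 (x', i'))) ⟨x₂, μ⟩)
              - covDeriv C B (op116 C Finset.univ A B msq a k 1 (n' + 1) (cb P N 0 (x', i'))) ⟨x₁, μ⟩‖ := by
    intro i'
    rw [← holT_apply, ← holT_apply, op116_zero_succ_split hL hmsq ha hk n' (cb P N 0 (x', i')), map_add]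
    have hWi : propagatorK C Finset.univ B msq a k (srcV C A B k Finset.univ a
        (propagatorK C Finset.univ B msq a k (f^[n'] (cb P N 0 (x', i'))))) =
        propagatorK C Finset.univ B msq a k (srcV C A B k Finset.univ a (W i')) := rfl
    rw [hWi]
    exact norm_add_le _ _
  -- assembly
  have hsum := Finset.sum_le_sum fun i' (_ : i' ∈ (Finset.univ : Finset (Ix N))) => hsplit i'
  rw [Finset.sum_add_distrib] at hsum
  have hA1 : q * (holC P N C k a δ₁ Cst s δA α cH n' * P.mesh k ^ (n' + 1) * S) *
        Real.exp (-(rateAt P N C k a Cst s δA δ₁ (P.mesh 0 ^ P.d * Cst) (cK1 P C k Cst s) (n' + 1) * m))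
      ≤ q * (holC P N C k a δ₁ Cst s δA α cH n' * P.mesh k ^ (n' + 1) * S) *
        Real.exp (-(rateAt P N C k a Cst s δA δ₁ (P.mesh 0 ^ P.d * Cst) (cK1 P C k Cst s) (n' + 2) * m)) := by
    have hd1 : (P.d : ℝ) < 1 + ((n' + 1 : ℕ) : ℝ) - α := hd
    have hC1 : 0 ≤ holC P N C k a δ₁ Cst s δA α cH n' :=
      B3Op116HolderKernelRegularTorus.holC_nonneg hL hδ₁ hCst hs hδA hα1 hcH n' hd1
    have : 0 ≤ q * (holC P N C k a δ₁ Cst s δA α cH n' * P.mesh k ^ (n' + 1) * S) := by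
      have := P.mesh_pos k; positivity
    exact mul_le_mul_of_nonneg_left hexp this
  calc (P.mesh 0 ^ P.d)⁻¹ * ∑ i' : Ix N,
        ‖hol C B x₁ Γ (covDeriv C B (op116 C Finset.univ A B msq a k 0 (n' + 1) (cb P N 0 (x', i'))) ⟨x₂, μ⟩)
          - covDeriv C B (op116 C Finset.univ A B msq a k 0 (n' + 1) (cb P N 0 (x', i'))) ⟨x₁, μ⟩‖
      ≤ (P.mesh 0 ^ P.d)⁻¹ * ((∑ i' : Ix N,
            ‖holT C B x₁ x₂ Γ μ (propagatorK C Finset.univ B msq a k (srcV C A B k Finset.univ a (W i')))‖)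
          + ∑ i' : Ix N, ‖hol C B x₁ Γ (covDeriv C B (op116 C Finset.univ A B msq a k 1 (n' + 1) (cb P N 0 (x', i'))) ⟨x₂, μ⟩)
              - covDeriv C B (op116 C Finset.univ A B msq a k 1 (n' + 1) (cb P N 0 (x', i'))) ⟨x₁, μ⟩‖) :=
        mul_le_mul_of_nonneg_left hsum hε
    _ = (P.mesh 0 ^ P.d)⁻¹ * ∑ i' : Ix N,
            ‖holT C B x₁ x₂ Γ μ (propagatorK C Finset.univ B msq a k (srcV C A B k Finset.univ a (W i')))‖
          + (P.mesh 0 ^ P.d)⁻¹ * ∑ i' : Ix N,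
            ‖hol C B x₁ Γ (covDeriv C B (op116 C Finset.univ A B msq a k 1 (n' + 1) (cb P N 0 (x', i'))) ⟨x₂, μ⟩)
              - covDeriv C B (op116 C Finset.univ A B msq a k 1 (n' + 1) (cb P N 0 (x', i'))) ⟨x₁, μ⟩‖ := mul_add _ _ _
    _ ≤ q * (holC P N C k a δ₁ Cst s δA α cH n' * P.mesh k ^ (n' + 1) * S) *
          Real.exp (-(rateAt P N C k a Cst s δA δ₁ (P.mesh 0 ^ P.d * Cst) (cK1 P C k Cst s) (n' + 1) * m))
        + q * (holC P N C k a δ₁ Cst s δA α cH (n' + 1) * P.mesh k ^ (n' + 2) * S) *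
          Real.exp (-(rateAt P N C k a Cst s δA δ₁ (P.mesh 0 ^ P.d * Cst) (cK1 P C k Cst s) (n' + 2) * m)) :=
        add_le_add h1 h2
    _ ≤ q * (holC P N C k a δ₁ Cst s δA α cH n' * P.mesh k ^ (n' + 1) * S) *
          Real.exp (-(rateAt P N C k a Cst s δA δ₁ (P.mesh 0 ^ P.d * Cst) (cK1 P C k Cst s) (n' + 2) * m))
        + q * (holC P N C k a δ₁ Cst s δA α cH (n' + 1) * P.mesh k ^ (n' + 2) * S) *
          Real.exp (-(rateAt P N C k a Cst s δA δ₁ (P.mesh 0 ^ P.d * Cst) (cK1 P C k Cst s) (n' + 2) * m)) :=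
        add_le_add hA1 le_rfl
    _ = _ := by ring

omit hδ₁1 h210B h210AB hmsq ha hk hkK i₀ hA hregA h211 in
/-- the sign of the packaged constant: `holC(n′) + holC(n′+1) ≥ 0` above the threshold `d < 1 + (n′+1) − α`.
[cite: Balaban1983Higgs3, (1.16) p.414] -/
theorem holC_add_nonneg (hL : 1 < P.L) (n' : ℕ) (hd : (P.d : ℝ) < 1 + ((n' + 1 : ℕ) : ℝ) - α) :
    0 ≤ holC P N C k a δ₁ Cst s δA α cH n' + holC P N C k a δ₁ Cst s δA α cH (n' + 1) := by
  have hd' : (P.d : ℝ) < 1 + ((n' + 1 + 1 : ℕ) : ℝ) - α := by push_cast at hd ⊢; linarith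
  exact add_nonneg (B3Op116HolderKernelRegularTorus.holC_nonneg hL hδ₁ hCst hs hδA hα1 hcH n' hd)
    (B3Op116HolderKernelRegularTorus.holC_nonneg hL hδ₁ hCst hs hδA hα1 hcH (n' + 1) hd')

/-- **PACKAGED FORM (p40's binder `hH` at `(n, n′) = (0, n′+1)`)**: for `L^kε ≤ 1` the two terms merge into ONE constant,
`ε^{−d}Σ_{i′}‖U(B̃(Γ))(D^ε_{B̃}(1.16)_{0,n′+1}e_{(x′,i′)})(⟨x₂,μ⟩) − (…)(⟨x₁,μ⟩)‖
≤ (ε|x₁−x₂|)^α·((holC(n′) + holC(n′+1))·(L^kε)^{n′+1}·(L^kε)((L^kε)^d)^{−1}((L^kε)^α)^{−1})·exp(−δ_{n′+2}·min(|x₁−x′|,|x₂−x′|)/L^k)`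
(`C_H·t^{n+n′}` with `t ≥ L^kε`, the common rate `δ₁/(4L)^{n+n′+1}` of the (2.5) assembly `B3Ineq25Op116RegularTorus`).
[cite: Balaban1983Higgs3, (1.16) p.414, (2.5) p.424, (2.11) p.426] -/
theorem kernel116_holder_le_zero_left' (hmesh : P.mesh k ≤ 1) (n' : ℕ) (hd : (P.d : ℝ) < 1 + ((n' + 1 : ℕ) : ℝ) - α)
    (μ : Fin P.d) (x₁ x₂ x' : HiggsLattice.Site P 0) (hne : x₁ ≠ x₂) (Γ : List (HiggsLattice.Site P 0)) (hΓ : IsAdm x₁ x₂ Γ) :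
    (P.mesh 0 ^ P.d)⁻¹ * ∑ i' : Ix N,
        ‖hol C B x₁ Γ (covDeriv C B (op116 C Finset.univ A B msq a k 0 (n' + 1) (cb P N 0 (x', i'))) ⟨x₂, μ⟩)
          - covDeriv C B (op116 C Finset.univ A B msq a k 0 (n' + 1) (cb P N 0 (x', i'))) ⟨x₁, μ⟩‖
      ≤ (P.mesh 0 * (HiggsLattice.Site.tdist x₁ x₂ : ℝ)) ^ α *
          ((holC P N C k a δ₁ Cst s δA α cH n' + holC P N C k a δ₁ Cst s δA α cH (n' + 1)) * P.mesh k ^ (n' + 1) *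
            (P.mesh k * (P.mesh k ^ P.d)⁻¹ * (P.mesh k ^ α)⁻¹)) *
          Real.exp (-(rateAt P N C k a Cst s δA δ₁ (P.mesh 0 ^ P.d * Cst) (cK1 P C k Cst s) (n' + 2) *
            (min (HiggsLattice.Site.tdist x₁ x' : ℝ) (HiggsLattice.Site.tdist x₂ x' : ℝ) / (P.L : ℝ) ^ k))) := by
  have hL : 1 < P.L := hL1
  have h := kernel116_holder_le_zero_left hδ₁ hδ₁1 hCst h210B h210AB hmsq ha hk hkK i₀ hs hA hδA hregA hα1 hcH h211 n' hd μ
    x₁ x₂ x' hne Γ hΓ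
  refine h.trans ?_
  have hm0 : 0 < P.mesh k := P.mesh_pos k
  have hd' : (P.d : ℝ) < 1 + ((n' + 1 + 1 : ℕ) : ℝ) - α := by push_cast at hd ⊢; linarith
  have hC0 : 0 ≤ holC P N C k a δ₁ Cst s δA α cH n' := B3Op116HolderKernelRegularTorus.holC_nonneg hL hδ₁ hCst hs hδA hα1 hcH n' hd
  have hC1 : 0 ≤ holC P N C k a δ₁ Cst s δA α cH (n' + 1) :=
    B3Op116HolderKernelRegularTorus.holC_nonneg hL hδ₁ hCst hs hδA hα1 hcH (n' + 1) hd'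
  have hpow : P.mesh k ^ (n' + 2) ≤ P.mesh k ^ (n' + 1) := pow_le_pow_of_le_one hm0.le hmesh (by omega)
  have hkey : holC P N C k a δ₁ Cst s δA α cH n' * P.mesh k ^ (n' + 1)
        + holC P N C k a δ₁ Cst s δA α cH (n' + 1) * P.mesh k ^ (n' + 2)
      ≤ (holC P N C k a δ₁ Cst s δA α cH n' + holC P N C k a δ₁ Cst s δA α cH (n' + 1)) * P.mesh k ^ (n' + 1) := by
    rw [add_mul]
    exact add_le_add le_rfl (mul_le_mul_of_nonneg_left hpow hC1)
  have hq0 : 0 ≤ (P.mesh 0 * (HiggsLattice.Site.tdist x₁ x₂ : ℝ)) ^ α :=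
    Real.rpow_nonneg (mul_nonneg (P.mesh_pos 0).le (Nat.cast_nonneg _)) α
  have hS0 : 0 ≤ P.mesh k * (P.mesh k ^ P.d)⁻¹ * (P.mesh k ^ α)⁻¹ := by positivity
  exact mul_le_mul_of_nonneg_right (mul_le_mul_of_nonneg_left (mul_le_mul_of_nonneg_right hkey hS0) hq0) (Real.exp_pos _).le

end Zero

end Literature.MathematicalPhysics.QuantumFieldTheory.Balaban1983to89.B3Op116HolderKernelRegularTorusZero

end
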